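import Literature.NumberTheory.EllipticCurves.Voight2007.GenusFieldCriterionArithmetic
import Mathlib.NumberTheory.Multiplicity
import HarnessLib

/-!
# Voight 2007, Prop. 3.8 / Cor. 3.9 — `(m / ℓ) = 1` for the norms `ℓ = x² + txy − m₀y²` of
# `P_{K,ℤ}(f)` under the odd-prime and dyadic conditions (the assigned characters of `f² d_K`)

Topic `NumberTheory/EllipticCurves/Voight2007`. THEOREMS only; pure integer arithmetic (sequel of
`GenusFieldCriterionArithmetic.lean`), the local computation inside the proof of the containment
`ℚ(√m)K ⊆ K[f]` (`RingClassGenusFieldContainment.lean`). With `d = 2^{k_d} w_d = t² + 4m₀` (the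
discriminant of `K` on an integral basis `(1, ω)`, `ω² = m₀ + tω`), `m = 2^{k_m} w_m` fundamental,
and an odd prime `ℓ ∤ m` of the form `ℓ = x² + txy − m₀y²` with `f ∣ y`, `f ∣ x − a`
(`ℓ = N(α)`, `α ≡ a (mod f)`): if every odd prime factor of `m` divides `d` or `f` and the dyadic
table of Cor. 3.9 holds, then `(m/ℓ) = 1` — Cox, Lemma 1.14 / Thm. 6.1 (`(D/·)` is trivial on the
values of the principal form prime to `D`), made explicit through `jacobiSym_two_pow_mul_eq`.
HONEST FRAMING: elementary; nothing about fields is claimed here.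
Mathlib / tree search: `Voight2007.jacobiSym_eq_one_of_forall_isSquare`, `jacobiSym_two_pow_mul_eq`
(tree); Mathlib `ZMod.χ₈_nat_eq_if_mod_eight`, `ZMod.χ₄_nat_one_mod_four`, `Int.sq_mod_four_eq_one_of_odd`.

## References

* J. Voight, *Quadratic forms that represent almost the same primes*, Math. Comp. 76 (2007), §3
  Prop. 3.8, Cor. 3.9. [Voight2007]
* D. A. Cox, *Primes of the form x² + ny²*, 2nd ed. (2013): §1.C Lemma 1.14, §6.A Thm. 6.1. [Cox2013]
-/

namespace Literature.NumberTheory.EllipticCurves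

namespace Voight2007

open ZMod

/-- An odd square is `≡ 1 (mod 8)`. [folklore] -/
private theorem sq_emod_eight_of_odd {x : ℤ} (hx : Odd x) : x ^ 2 % 8 = 1 := by
  obtain ⟨c, rfl⟩ := hx
  obtain ⟨e, he⟩ := Int.even_mul_succ_self c
  have : (2 * c + 1) ^ 2 = 4 * (c * (c + 1)) + 1 := by ring
  rw [this, he]
  omega

/-- **`(m/ℓ) = 1` on the values `ℓ = x² + txy − m₀y²`, `f ∣ y`, of the principal form of
discriminant `f² d`** (`d = 2^{k_d} w_d = t² + 4m₀`, `m = 2^{k_m} w_m` fundamental), for an odd prime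
`ℓ ∤ m`, under Voight's conditions: every odd prime factor of `m` divides `d` or `f`, and the
dyadic table of Cor. 3.9. (Cox Lemma 1.14 / Thm. 6.1: the genus characters `(q*/·)`, `χ₄`, `χ₈`
of `f² d` are trivial on the values of the principal form.) [cite: Voight2007, §3 Prop. 3.8 and Cor. 3.9]
[cite: Cox2013, §1.C Lemma 1.14 and §6.A Thm. 6.1] -/
theorem jacobiSym_eq_one_of_norm_form {t m₀ : ℤ} {kd : ℕ} {wd : ℤ}
    (hdkw : 2 ^ kd * wd = t ^ 2 + 4 * m₀) (hwd : Odd wd)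
    (hkd : (kd = 0 ∧ wd % 4 = 1) ∨ (kd = 2 ∧ wd % 4 = 3) ∨ kd = 3)
    {m : ℤ} {km : ℕ} {wm : ℤ} (hmd : m = 2 ^ km * wm) (hwm : Odd wm)
    (hkm : (km = 0 ∧ wm % 4 = 1) ∨ (km = 2 ∧ wm % 4 = 3) ∨ km = 3) {f : ℕ}
    (hodd : ∀ q : ℕ, q.Prime → q ≠ 2 → (q : ℤ) ∣ m → (q : ℤ) ∣ 2 ^ kd * wd ∨ q ∣ f)
    (hT : km = 0 ∨ (km = 2 ∧ ((kd = 0 ∧ 4 ∣ f) ∨ kd = 2 ∨ (kd = 3 ∧ 2 ∣ f))) ∨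
      (km = 3 ∧ ((kd = 0 ∧ 8 ∣ f) ∨ (kd = 2 ∧ 4 ∣ f) ∨
        (kd = 3 ∧ (wm % 4 = wd % 4 ∨ 2 ∣ f)))))
    {ℓ : ℕ} (hprime : ℓ.Prime) (hℓ2 : ℓ ≠ 2) (hℓm : ¬ (ℓ : ℤ) ∣ m)
    {x y a : ℤ} (hfx : (f : ℤ) ∣ x - a) (hfy : (f : ℤ) ∣ y)
    (hN : (ℓ : ℤ) = x ^ 2 + t * x * y - m₀ * y ^ 2) : jacobiSym m ℓ = 1 := by
  set d : ℤ := 2 ^ kd * wd with hddef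
  have hdd : d = 2 ^ kd * wd := rfl
  have hdisc : d = t ^ 2 + 4 * m₀ := hdkw
  have hℓodd : Odd ℓ := hprime.odd_of_ne_two hℓ2
  have hℓoddZ : (ℓ : ℤ) % 2 = 1 := by
    have := Nat.odd_iff.mp hℓodd; omega
  have h4N : 4 * (ℓ : ℤ) = (2 * x + t * y) ^ 2 - d * y ^ 2 := by rw [hN, hdisc]; ring
  have hJw : jacobiSym (ℓ : ℤ) wm.natAbs = 1 := by
    refine jacobiSym_eq_one_of_forall_isSquare fun q hq hqw => ?_
    haveI : Fact q.Prime := ⟨hq⟩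
    have hqwZ : (q : ℤ) ∣ wm := Int.natCast_dvd.mpr hqw
    have hq2 : q ≠ 2 := by
      rintro rfl
      exact Int.not_even_iff_odd.mpr hwm (even_iff_two_dvd.mpr hqwZ)
    have hqm : (q : ℤ) ∣ m := by rw [hmd]; exact hqwZ.mul_left _
    -- `q ≠ ℓ`
    have hℓq : ((ℓ : ℤ) : ZMod q) ≠ 0 := by
      rw [Int.cast_natCast, Ne, ZMod.natCast_eq_zero_iff]
      intro hqℓ
      have : q = ℓ := (Nat.prime_dvd_prime_iff_eq hq hprime).mp hqℓ
      exact hℓm (this ▸ hqm)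
    refine ⟨hℓq, ?_⟩
    rcases hodd q hq hq2 hqm with hqd | hqf
    · -- `q ∣ d`: `4ℓ ≡ (2x + ty)² (mod q)`
      have h2q : (2 : ZMod q) ≠ 0 := by
        intro h
        have h' : ((2 : ℕ) : ZMod q) = 0 := by exact_mod_cast h
        rw [ZMod.natCast_eq_zero_iff] at h'
        exact hq2 ((Nat.prime_dvd_prime_iff_eq hq Nat.prime_two).mp h')
      have hdq : ((d : ℤ) : ZMod q) = 0 := (ZMod.intCast_zmod_eq_zero_iff_dvd d q).mpr hqd
      have h4 : (4 : ZMod q) * ((ℓ : ℤ) : ZMod q) = (((2 * x + t * y : ℤ) : ZMod q)) ^ 2 := by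
        have := congrArg (Int.cast : ℤ → ZMod q) h4N
        push_cast at this ⊢
        rw [this, hdq]
        ring
      refine ⟨((2 * x + t * y : ℤ) : ZMod q) / 2, ?_⟩
      field_simp
      linear_combination h4
    · -- `q ∣ f`: `ℓ ≡ a² (mod q)`
      have hqZ : (q : ℤ) ∣ (f : ℤ) := Int.natCast_dvd_natCast.mpr hqf
      have hy0 : ((y : ℤ) : ZMod q) = 0 :=
        (ZMod.intCast_zmod_eq_zero_iff_dvd y q).mpr (hqZ.trans hfy)
      have hxa : ((x : ℤ) : ZMod q) = ((a : ℤ) : ZMod q) := by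
        have h0 : (((x - a : ℤ)) : ZMod q) = 0 :=
          (ZMod.intCast_zmod_eq_zero_iff_dvd (x - a) q).mpr (hqZ.trans hfx)
        rw [Int.cast_sub, sub_eq_zero] at h0
        exact h0
      refine ⟨((a : ℤ) : ZMod q), ?_⟩
      have := congrArg (Int.cast : ℤ → ZMod q) hN
      push_cast at this hy0 hxa ⊢
      rw [this, hy0, hxa]
      ring
  -- parity of `t` when `4 ∣ d`
  have hteven : kd = 2 ∨ kd = 3 → ∃ t' : ℤ, t = t' + t' := by
    intro hkd'
    rcases Int.even_or_odd t with ht' | htodd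
    · exact ht'
    · exfalso
      have h8 := sq_emod_eight_of_odd htodd
      have hd' : d = 2 ^ kd * wd := hdd
      rcases hkd' with rfl | rfl
      · norm_num at hd'
        omega
      · norm_num at hd'
        omega
  -- `x` resp. `X = x + t' y` is odd when `y` is even (`ℓ` is odd)
  -- residue facts
  have hresA : (4 : ℤ) ∣ y → (ℓ : ℤ) % 4 = 1 := by
    rintro ⟨y', hy'⟩
    rcases Int.even_or_odd x with ⟨x', hx'⟩ | hxodd
    · exfalso
      have : (ℓ : ℤ) = 4 * (x' ^ 2) + 8 * (t * x' * y') - 16 * (m₀ * y' ^ 2) := by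
        rw [hN, hx', hy']; ring
      omega
    · have h8 := sq_emod_eight_of_odd hxodd
      have : (ℓ : ℤ) = x ^ 2 + 4 * (t * x * y') - 16 * (m₀ * y' ^ 2) := by
        rw [hN, hy']; ring
      omega
  have hresB : (8 : ℤ) ∣ y → (ℓ : ℤ) % 8 = 1 := by
    rintro ⟨y', hy'⟩
    rcases Int.even_or_odd x with ⟨x', hx'⟩ | hxodd
    · exfalso
      have : (ℓ : ℤ) = 4 * (x' ^ 2) + 16 * (t * x' * y') - 64 * (m₀ * y' ^ 2) := by
        rw [hN, hx', hy']; ring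
      omega
    · have h8 := sq_emod_eight_of_odd hxodd
      have : (ℓ : ℤ) = x ^ 2 + 8 * (t * x * y') - 64 * (m₀ * y' ^ 2) := by
        rw [hN, hy']; ring
      omega
  have hresC : kd = 2 → (ℓ : ℤ) % 4 = 1 := by
    intro hkd2
    obtain ⟨t', ht'⟩ := hteven (Or.inl hkd2)
    have hd' : d = 2 ^ kd * wd := hdd
    rw [hkd2] at hd'
    norm_num at hd'
    have hwd' : wd = t' ^ 2 + m₀ := by
      have : 4 * wd = (t' + t') ^ 2 + 4 * m₀ := by rw [← hd', hdisc, ht']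
      linarith
    have hℓX : (ℓ : ℤ) = (x + t' * y) ^ 2 - wd * y ^ 2 := by
      rw [hN, ht', hwd']; ring
    have hwd4 : wd % 4 = 3 := by
      rcases hkd with ⟨h0, -⟩ | ⟨-, h3⟩ | h3 <;> omega
    rcases Int.even_or_odd (x + t' * y) with ⟨X', hX'⟩ | hXodd <;>
      rcases Int.even_or_odd y with ⟨y', hy'⟩ | hyodd
    · exfalso
      have : (ℓ : ℤ) = 4 * (X' ^ 2) - 4 * (wd * y' ^ 2) := by rw [hℓX, hX', hy']; ring
      omega
    · have h8 := sq_emod_eight_of_odd hyodd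
      obtain ⟨c, hc⟩ : ∃ c : ℤ, y ^ 2 = 8 * c + 1 := ⟨y ^ 2 / 8, by omega⟩
      have : (ℓ : ℤ) = 4 * (X' ^ 2) - 8 * (wd * c) - wd := by rw [hℓX, hX', hc]; ring
      omega
    · have h8 := sq_emod_eight_of_odd hXodd
      have : (ℓ : ℤ) = (x + t' * y) ^ 2 - 4 * (wd * y' ^ 2) := by rw [hℓX, hy']; ring
      omega
    · exfalso
      have h8 := sq_emod_eight_of_odd hXodd
      have h8' := sq_emod_eight_of_odd hyodd
      obtain ⟨c, hc⟩ : ∃ c : ℤ, y ^ 2 = 8 * c + 1 := ⟨y ^ 2 / 8, by omega⟩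
      have : (ℓ : ℤ) = (x + t' * y) ^ 2 - 8 * (wd * c) - wd := by rw [hℓX, hc]; ring
      omega
  have hresDE : kd = 3 → ((2 : ℤ) ∣ y → (ℓ : ℤ) % 8 = 1) ∧
      (¬ (2 : ℤ) ∣ y → ((ℓ : ℤ) + 2 * wd) % 8 = 1) := by
    intro hkd3
    obtain ⟨t', ht'⟩ := hteven (Or.inr hkd3)
    have hd' : d = 2 ^ kd * wd := hdd
    rw [hkd3] at hd'
    norm_num at hd'
    have hwd' : 2 * wd = t' ^ 2 + m₀ := by
      have : 8 * wd = (t' + t') ^ 2 + 4 * m₀ := by rw [← hd', hdisc, ht']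
      linarith
    have hℓX : (ℓ : ℤ) = (x + t' * y) ^ 2 - 2 * wd * y ^ 2 := by
      rw [hN, ht', show m₀ = 2 * wd - t' ^ 2 by linarith]; ring
    have hXodd : Odd (x + t' * y) := by
      rcases Int.even_or_odd (x + t' * y) with ⟨X', hX'⟩ | hXodd
      · exfalso
        have : (ℓ : ℤ) = 4 * (X' ^ 2) - 2 * (wd * y ^ 2) := by rw [hℓX, hX']; ring
        omega
      · exact hXodd
    have h8 := sq_emod_eight_of_odd hXodd
    constructor
    · rintro ⟨y', hy'⟩
      have : (ℓ : ℤ) = (x + t' * y) ^ 2 - 8 * (wd * y' ^ 2) := by rw [hℓX, hy']; ring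
      omega
    · intro hy2
      have hyodd : Odd y := Int.not_even_iff_odd.mp (fun h => hy2 (even_iff_two_dvd.mp h))
      have h8' := sq_emod_eight_of_odd hyodd
      obtain ⟨c, hc⟩ : ∃ c : ℤ, y ^ 2 = 8 * c + 1 := ⟨y ^ 2 / 8, by omega⟩
      have : (ℓ : ℤ) = (x + t' * y) ^ 2 - 16 * (wd * c) - 2 * wd := by rw [hℓX, hc]; ring
      omega
  -- values of `χ₄`, `χ₈` at `ℓ`
  have hℓ2' : ℓ % 2 = 1 := Nat.odd_iff.mp hℓodd
  have hχ₈sq : χ₈ (ℓ : ZMod 8) ^ 2 = 1 := by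
    rw [χ₈_nat_eq_if_mod_eight, if_neg (by omega)]
    split_ifs <;> norm_num
  have hχ₈one : (ℓ : ℤ) % 8 = 1 → χ₈ (ℓ : ZMod 8) = 1 := fun h => by
    rw [χ₈_nat_eq_if_mod_eight, if_neg (by omega), if_pos (by omega)]
  have hχ₄one : (ℓ : ℤ) % 4 = 1 → χ₄ (ℓ : ZMod 4) = 1 := fun h =>
    χ₄_nat_one_mod_four (by omega)
  -- `(m / ℓ) = 1`
  have hfy4 : 4 ∣ f → (4 : ℤ) ∣ y := fun h => (Int.natCast_dvd_natCast.mpr h).trans hfy |> fun h' =>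
    by exact_mod_cast h'
  have hfy8 : 8 ∣ f → (8 : ℤ) ∣ y := fun h => (Int.natCast_dvd_natCast.mpr h).trans hfy |> fun h' =>
    by exact_mod_cast h'
  have hfy2 : 2 ∣ f → (2 : ℤ) ∣ y := fun h => (Int.natCast_dvd_natCast.mpr h).trans hfy |> fun h' =>
    by exact_mod_cast h'
  have hJ : jacobiSym m ℓ = 1 := by
    rw [hmd, jacobiSym_two_pow_mul_eq hwm hℓodd hJw]
    rcases hkm with ⟨hk, hw⟩ | ⟨hk, hw⟩ | hk
    · rw [hk, pow_zero, one_mul, if_pos hw]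
    · -- `km = 2`: `ℓ ≡ 1 (mod 4)`
      have hℓ4 : (ℓ : ℤ) % 4 = 1 := by
        rcases hT with h0 | ⟨-, hT2⟩ | ⟨h3, -⟩
        · omega
        · rcases hT2 with ⟨-, h4f⟩ | hkd2 | ⟨hkd3, h2f⟩
          · exact hresA (hfy4 h4f)
          · exact hresC hkd2
          · have := (hresDE hkd3).1 (hfy2 h2f); omega
        · omega
      rw [hk, if_neg (by omega), hχ₈sq, hχ₄one hℓ4, mul_one]
    · -- `km = 3`
      rw [hk, pow_succ, hχ₈sq, one_mul]
      rcases hT with h0 | ⟨h2, -⟩ | ⟨-, hT3⟩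
      · omega
      · omega
      · -- first the cases with `ℓ ≡ 1 (mod 8)`
        have hone : (ℓ : ℤ) % 8 = 1 →
            χ₈ (ℓ : ZMod 8) * (if wm % 4 = 1 then 1 else χ₄ (ℓ : ZMod 4)) = 1 := fun h => by
          rw [hχ₈one h, one_mul]
          split_ifs
          · rfl
          · exact hχ₄one (by omega)
        rcases hT3 with ⟨-, h8f⟩ | ⟨hkd2, h4f⟩ | ⟨hkd3, hlast⟩
        · exact hone (hresB (hfy8 h8f))
        · -- `kd = 2`, `4 ∣ f`: `t` even and `4 ∣ y` give `ℓ ≡ 1 (mod 8)`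
          obtain ⟨t', ht'⟩ := hteven (Or.inl hkd2)
          obtain ⟨y', hy'⟩ := hfy4 h4f
          have hℓ8 : (ℓ : ℤ) % 8 = 1 := by
            rcases Int.even_or_odd x with ⟨x', hx'⟩ | hxodd
            · exfalso
              have : (ℓ : ℤ) = 4 * (x' ^ 2) + 16 * (t' * x' * y') - 16 * (m₀ * y' ^ 2) := by
                rw [hN, hx', hy', ht']; ring
              omega
            · have h8 := sq_emod_eight_of_odd hxodd
              have : (ℓ : ℤ) = x ^ 2 + 8 * (t' * x * y') - 16 * (m₀ * y' ^ 2) := by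
                rw [hN, hy', ht']; ring
              omega
          exact hone hℓ8
        · by_cases hy2 : (2 : ℤ) ∣ y
          · exact hone ((hresDE hkd3).1 hy2)
          · have hℓwd := (hresDE hkd3).2 hy2
            have hwmwd : wm % 4 = wd % 4 := by
              rcases hlast with h | h2f
              · exact h
              · exact absurd (hfy2 h2f) hy2
            have hwd4 : wd % 4 = 1 ∨ wd % 4 = 3 := by have := Int.odd_iff.mp hwd; omega
            rcases hwd4 with hwd1 | hwd3
            · -- `ℓ ≡ 7 (mod 8)`, `wm ≡ 1 (mod 4)`
              have hℓ8 : ℓ % 8 = 7 := by omega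
              rw [if_pos (by omega), χ₈_nat_eq_if_mod_eight, if_neg (by omega), if_pos (by omega),
                mul_one]
            · -- `ℓ ≡ 3 (mod 8)`, `wm ≡ 3 (mod 4)`
              have hℓ8 : ℓ % 8 = 3 := by omega
              rw [if_neg (by omega), χ₈_nat_eq_if_mod_eight, if_neg (by omega), if_neg (by omega),
                χ₄_nat_three_mod_four (by omega)]
              norm_num
  -- hence `m` is a non-zero square mod `ℓ`, and `v` splits in `Q`
  exact hJ

end Voight2007

end Literature.NumberTheory.EllipticCurves
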